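import Summits.QuantumFields.YangMills.Theorems.UnitScaleTiltHalvingCompetitorMapFibreLocal
import HarnessLib

/-!
# Route `UnitScaleTilt`, crux K1 child «MinimiserStabilityRegPr» (stmt-QuantumFields-19200), registered stub `stub_halvingStep` (H), door v3 (Stat currency),
# row B5 «DIFFERENTIABLE GAUGE FIX» (LEAD ★w5-19200 g4 RULING L-7 (a)) — **THE STAT TRANSFER ALONG A COMPETITOR LINE** (the Stat twin of ✓B4 §1
# `hmin_of_hcrit_exists_gauge`; LEAD-H 11:36:33Z «two lines the L4-Stat writer will use», made a lemma): STATIONARITY of the Wilson action at the member `U` along every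
# bondwise-differentiable curve in the EXACT fibre through `U` ⟹ `deriv (t ↦ 𝒲(W_t)) 0 = 0` for every competitor line `t ↦ W_t` with `W_0 = u • U`, an `SU(2)` gauge
# family `h_t` putting `h_t • W_t` in the fibre for `|t| < r`, and `t ↦ ↑(h_t x)`, `t ↦ ↑(W_t b)` differentiable at `0`

Cell `ym3-torus` (HUMAN RULING D-0037, YM ladder rung R3 — continuum SU(2) YM₃ on the torus is a RUNG, not the Clay problem), width seat `ym-ust-19200-w1` gen 8.
`--supports stmt-QuantumFields-19200 --as helper`; def-free, 0 sorry, standard axioms; counts toward nothing by itself.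

WHY.  Door v3 (`RoomHalvingTextStat`, L-7 (a)) displays, in place of `IsCritical V U`, the first-order clause
  `Stat(U) : ∀ γ, γ 0 = U → (∀ t, γ t ∈ fibre … V) → (∀ b, DifferentiableAt ℝ (t ↦ ↑(γ t b)) 0) → deriv (t ↦ 𝒲(γ t)) 0 = 0`
(✓`Prop7StubEXOfChartPiecesTwSL` :179–182 VERBATIM).  The C_E end of the knit (FILE A twin ✓`HalvingDressedStationaritySU2.tracePairing_of_derivZero_localChart`, p06 g3) wants
`hstat : deriv (t ↦ 𝒲 (Φloc (A + t • Y))) 0 = 0` per direction; this file is the bridge, given the differentiable gauge fix of the row (files A∕B∕C): (1) the curve must lie in the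
fibre for ALL `t` — clamp the parameter, `c t := max (−r∕2) (min (r∕2) t)`, which is the identity near `0`; (2) it must pass through `U` itself — both `U` and `h_0 • W_0 =
(h_0·u) • U` lie in the fibre, so the constant gauge `g₀ := (h_0·u)⁻¹` maps fibre members to fibre members (lit ✓`gaugeAct_mem_fibre_iff`, ✓`descendTo_gaugeAct`) and
`γ t := (g₀·h_{c t}) • W_{c t}` has `γ 0 = U`; (3) `𝒲(γ t) = 𝒲(W_{c t})` (lit ✓`wilsonAction_gaugeAct`) and `Filter.EventuallyEq.deriv_eq` removes the clamp.  No
differentiability of `𝒲` is used.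

WHAT IS PROVED (ns `…Theorems.HalvingCompetitorMapFibreStat`).
* §1 `clamp_eventuallyEq_id`, `abs_clamp_le` — the clamp.  `gaugeAct_one`, `gaugeAct_inv_mem_fibre` — a constant gauge whose product with a fibre-to-fibre gauge is trivial
  maps the fibre to itself (from lit ✓`gaugeAct_mem_fibre_iff`).  `differentiableAt_coe_gaugeAct` — `t ↦ ↑((g_t • W_t) b)` is differentiable when `t ↦ ↑(g_t x)` and
  `t ↦ ↑(W_t b)` are (`↑(a⁻¹) = star ↑a` in `SU(2)`, `DifferentiableAt.star` over `ℝ`).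
* §2 ★★ `deriv_wilsonAction_line_eq_zero_of_stat` — the statement of the title.
HONEST SCOPE: first-order bookkeeping; the gauge family is an INPUT here (supplied by the row's file C on chart lines); nothing of print is asserted; NOT a claim about the
stub, the crux, the rung or a mass gap.

References: T. Bałaban, CMP **102** (1985) 277–309 [Balaban1985Variational] ((3)–(6) p.278, (111) p.294, (150) p.301, (157) p.302).
-/

set_option autoImplicit false

noncomputable section

open scoped Matrix.Norms.L2Operator Topology
open Filter

namespace Summit.QuantumFields.YangMills.Theorems.HalvingCompetitorMapFibreStat

open Literature.MathematicalPhysics.QuantumFieldTheory.Balaban1983to89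
open Literature.MathematicalPhysics.QuantumFieldTheory.Balaban1983to89.T3ContinuumYM3Torus
open Literature.MathematicalPhysics.QuantumFieldTheory.Balaban1983to89.T3UnitLawDensityEML (ℰp)
open Literature.MathematicalPhysics.QuantumFieldTheory.Balaban1983to89.T3TiltDescent (descendTo)
open Literature.MathematicalPhysics.QuantumFieldTheory.Balaban1983to89.T3ConstrainedMinimiser (fibre)
open Literature.MathematicalPhysics.QuantumFieldTheory.Balaban1983to89.T3PrintedRegularOrbits (descTransf gaugeAct_mem_fibre_iff)
open Literature.MathematicalPhysics.QuantumFieldTheory.Balaban1983to89.T3UnitLawGaugeInvariance (gaugeAct_gaugeAct)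
open T4Continuum

/-! ## §1 The clamp, constant gauges on the fibre, differentiability of gauge copies -/

section Tools

/-- the clamp `t ↦ max (−ρ) (min ρ t)` is the identity near `0` (`0 < ρ`). [folklore] -/
theorem clamp_eventuallyEq_id {ρ : ℝ} (hρ : 0 < ρ) : (fun t : ℝ => max (-ρ) (min ρ t)) =ᶠ[𝓝 0] fun t => t := by
  filter_upwards [Ioo_mem_nhds (show -ρ < 0 by linarith) hρ] with t ht
  rw [min_eq_right ht.2.le, max_eq_right ht.1.le]

/-- the clamp stays in `[−ρ, ρ]`. [folklore] -/
theorem abs_clamp_le {ρ : ℝ} (hρ : 0 ≤ ρ) (t : ℝ) : |max (-ρ) (min ρ t)| ≤ ρ :=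
  abs_le.2 ⟨le_max_left _ _, max_le (by linarith) (min_le_left _ _)⟩

variable {F : T3Family} {n K : ℕ}

/-- the trivial gauge transformation acts trivially. [folklore] -/
theorem gaugeAct_one (W : GaugeField (F.P K) 0 (Matrix.specialUnitaryGroup (Fin 2) ℂ)) :
    GaugeField.gaugeAct (fun _ => (1 : Matrix.specialUnitaryGroup (Fin 2) ℂ)) W = W := by
  funext b; simp [GaugeField.gaugeAct]

/-- **A CONSTANT GAUGE INVERSE TO A FIBRE-TO-FIBRE GAUGE MAPS THE FIBRE TO ITSELF**: if `U ∈ 𝔅_k(V)` and `a • U ∈ 𝔅_k(V)`, then `a⁻¹ • Z ∈ 𝔅_k(V)` for every `Z ∈ 𝔅_k(V)`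
(the descended gauge `a↓` stabilises `V`; lit ✓`gaugeAct_mem_fibre_iff`, ✓`descendTo_gaugeAct`). [cite: Balaban1985Variational, (3)-(4) p.278] -/
theorem gaugeAct_inv_mem_fibre (hnK : n ≤ K) {V : GaugeField (F.P n) 0 (Matrix.specialUnitaryGroup (Fin 2) ℂ)}
    {U : GaugeField (F.P K) 0 (Matrix.specialUnitaryGroup (Fin 2) ℂ)} (hU : U ∈ fibre F ℰp n K hnK V)
    (a : GaugeTransf (F.P K) 0 (Matrix.specialUnitaryGroup (Fin 2) ℂ)) (haU : GaugeField.gaugeAct a U ∈ fibre F ℰp n K hnK V)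
    {Z : GaugeField (F.P K) 0 (Matrix.specialUnitaryGroup (Fin 2) ℂ)} (hZ : Z ∈ fibre F ℰp n K hnK V) :
    GaugeField.gaugeAct (fun x => (a x)⁻¹) Z ∈ fibre F ℰp n K hnK V := by
  -- the descended gauge stabilises `V`
  have h1 : descendTo F ℰp n K hnK (GaugeField.gaugeAct a U) = V := haU
  have h2 : descendTo F ℰp n K hnK U = V := hU
  have hstab : GaugeField.gaugeAct (descTransf F n K hnK a) V = V := by
    rw [T3PrintedRegularOrbits.descendTo_gaugeAct, h2] at h1; exact h1
  -- `a • (a⁻¹ • Z) = Z ∈ fibre V = fibre (a↓ • V)`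
  have h3 : GaugeField.gaugeAct a (GaugeField.gaugeAct (fun x => (a x)⁻¹) Z) = Z := by
    rw [gaugeAct_gaugeAct]
    have : (fun x => a x * (a x)⁻¹) = fun _ => (1 : Matrix.specialUnitaryGroup (Fin 2) ℂ) := funext fun x => mul_inv_cancel _
    rw [this, gaugeAct_one]
  have h4 : GaugeField.gaugeAct a (GaugeField.gaugeAct (fun x => (a x)⁻¹) Z) ∈ fibre F ℰp n K hnK (GaugeField.gaugeAct (descTransf F n K hnK a) V) := by
    rw [h3, hstab]; exact hZ
  exact (gaugeAct_mem_fibre_iff F hnK ℰp a _ V).1 h4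

/-- **A GAUGE COPY OF A DIFFERENTIABLE LINE BY A DIFFERENTIABLE GAUGE FAMILY IS DIFFERENTIABLE**, bond by bond, read in `M₂(ℂ)`: `↑((g_t • W_t) b) = ↑(g_t b₋)·↑(W_t b)·star ↑(g_t b₊)`.
[cite: Balaban1985Averaging, (8) p.19] -/
theorem differentiableAt_coe_gaugeAct (g : ℝ → GaugeTransf (F.P K) 0 (Matrix.specialUnitaryGroup (Fin 2) ℂ))
    (W : ℝ → GaugeField (F.P K) 0 (Matrix.specialUnitaryGroup (Fin 2) ℂ)) {t₀ : ℝ} (b : PBond (F.P K) 0)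
    (hg : ∀ x, DifferentiableAt ℝ (fun t => ((g t x : Matrix.specialUnitaryGroup (Fin 2) ℂ) : Matrix (Fin 2) (Fin 2) ℂ)) t₀)
    (hW : DifferentiableAt ℝ (fun t => ((W t b : Matrix.specialUnitaryGroup (Fin 2) ℂ) : Matrix (Fin 2) (Fin 2) ℂ)) t₀) :
    DifferentiableAt ℝ (fun t => ((GaugeField.gaugeAct (g t) (W t) b : Matrix.specialUnitaryGroup (Fin 2) ℂ) : Matrix (Fin 2) (Fin 2) ℂ)) t₀ := by
  have h : (fun t => ((GaugeField.gaugeAct (g t) (W t) b : Matrix.specialUnitaryGroup (Fin 2) ℂ) : Matrix (Fin 2) (Fin 2) ℂ)) = fun t =>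
      ((g t b.src : Matrix.specialUnitaryGroup (Fin 2) ℂ) : Matrix (Fin 2) (Fin 2) ℂ) * ((W t b : Matrix.specialUnitaryGroup (Fin 2) ℂ) : Matrix (Fin 2) (Fin 2) ℂ) *
        star ((g t b.tgt : Matrix.specialUnitaryGroup (Fin 2) ℂ) : Matrix (Fin 2) (Fin 2) ℂ) := by
    funext t
    simp only [GaugeField.gaugeAct, Submonoid.coe_mul, ← Matrix.star_eq_inv, Matrix.specialUnitaryGroup.coe_star]
  rw [h]
  exact ((hg b.src).mul hW).mul (hg b.tgt).star

end Tools

/-! ## §2 Stat transfer along a competitor line -/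

section Stat

variable {F : T3Family} {n K : ℕ}

/-- ★★ **STATIONARITY AT THE MEMBER ⟹ THE WILSON ACTION IS STATIONARY ALONG EVERY GAUGE-FIXABLE DIFFERENTIABLE COMPETITOR LINE THROUGH A GAUGE COPY OF IT.**  `U ∈ 𝔅_k(V)`
satisfies door v3's first-order clause `Stat(U)` (VERBATIM); `t ↦ W_t` is a line of `SU(2)` configurations with `W_0 = u • U`, bondwise differentiable at `0`; `h_t` is an
`SU(2)` gauge family with `h_t • W_t ∈ 𝔅_k(V)` for `|t| < r` (`0 < r`) and `t ↦ ↑(h_t x)` differentiable at `0` at every site.  THEN `deriv (t ↦ 𝒲(W_t)) 0 = 0`.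
Proof: `γ t := ((h_0·u)⁻¹·h_{c t}) • W_{c t}` with the clamp `c`, then `Stat(U) γ`, gauge invariance of `𝒲`, `Filter.EventuallyEq.deriv_eq`.
[cite: Balaban1985Variational, (3)-(6) p.278, (111) p.294, (150) p.301, (157) p.302] -/
theorem deriv_wilsonAction_line_eq_zero_of_stat (hnK : n ≤ K) (V : GaugeField (F.P n) 0 (Matrix.specialUnitaryGroup (Fin 2) ℂ))
    {U : GaugeField (F.P K) 0 (Matrix.specialUnitaryGroup (Fin 2) ℂ)} (hU : U ∈ fibre F ℰp n K hnK V)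
    (hstat : ∀ γ : ℝ → GaugeField (F.P K) 0 (Matrix.specialUnitaryGroup (Fin 2) ℂ), γ 0 = U → (∀ t, γ t ∈ fibre F ℰp n K hnK V) →
      (∀ b, DifferentiableAt ℝ (fun t => ((γ t b : Matrix.specialUnitaryGroup (Fin 2) ℂ) : Matrix (Fin 2) (Fin 2) ℂ)) 0) →
      deriv (fun t => wilsonAction4 (γ t)) 0 = 0)
    (W : ℝ → GaugeField (F.P K) 0 (Matrix.specialUnitaryGroup (Fin 2) ℂ)) (u : GaugeTransf (F.P K) 0 (Matrix.specialUnitaryGroup (Fin 2) ℂ))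
    (hW0 : W 0 = GaugeField.gaugeAct u U)
    (hWd : ∀ b, DifferentiableAt ℝ (fun t => ((W t b : Matrix.specialUnitaryGroup (Fin 2) ℂ) : Matrix (Fin 2) (Fin 2) ℂ)) 0)
    {r : ℝ} (hr : 0 < r) (h : ℝ → GaugeTransf (F.P K) 0 (Matrix.specialUnitaryGroup (Fin 2) ℂ))
    (hfib : ∀ t : ℝ, |t| < r → GaugeField.gaugeAct (h t) (W t) ∈ fibre F ℰp n K hnK V)
    (hhd : ∀ x, DifferentiableAt ℝ (fun t => ((h t x : Matrix.specialUnitaryGroup (Fin 2) ℂ) : Matrix (Fin 2) (Fin 2) ℂ)) 0) :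
    deriv (fun t => wilsonAction4 (W t)) 0 = 0 := by
  -- the clamp
  let c : ℝ → ℝ := fun t => max (-(r / 2)) (min (r / 2) t)
  have hc0 : c 0 = 0 := by
    show max (-(r / 2)) (min (r / 2) 0) = 0
    rw [min_eq_right (by linarith), max_eq_right (by linarith)]
  have hcr : ∀ t, |c t| < r := fun t => (abs_clamp_le (by linarith : (0 : ℝ) ≤ r / 2) t).trans_lt (by linarith)
  have hcid : c =ᶠ[𝓝 0] fun t => t := clamp_eventuallyEq_id (by linarith : (0 : ℝ) < r / 2)
  -- the constant gauge `(h 0 · u)⁻¹`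
  let a : GaugeTransf (F.P K) 0 (Matrix.specialUnitaryGroup (Fin 2) ℂ) := fun x => h 0 x * u x
  have haU : GaugeField.gaugeAct a (U) ∈ fibre F ℰp n K hnK V := by
    have h0 := hfib 0 (by rw [abs_zero]; exact hr)
    rwa [hW0, gaugeAct_gaugeAct] at h0
  -- the curve
  let γ : ℝ → GaugeField (F.P K) 0 (Matrix.specialUnitaryGroup (Fin 2) ℂ) := fun t => GaugeField.gaugeAct (fun x => (a x)⁻¹ * h (c t) x) (W (c t))
  have hγ0 : γ 0 = U := by
    show GaugeField.gaugeAct (fun x => (a x)⁻¹ * h (c 0) x) (W (c 0)) = U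
    rw [hc0, hW0, gaugeAct_gaugeAct]
    have : (fun x => (a x)⁻¹ * h 0 x * u x) = fun _ => (1 : Matrix.specialUnitaryGroup (Fin 2) ℂ) := funext fun x => by
      show (h 0 x * u x)⁻¹ * h 0 x * u x = 1
      rw [mul_assoc, inv_mul_cancel]
    rw [this, gaugeAct_one]
  have hγfib : ∀ t, γ t ∈ fibre F ℰp n K hnK V := fun t => by
    show GaugeField.gaugeAct (fun x => (a x)⁻¹ * h (c t) x) (W (c t)) ∈ fibre F ℰp n K hnK V
    rw [← gaugeAct_gaugeAct]
    exact gaugeAct_inv_mem_fibre hnK hU a haU (hfib (c t) (hcr t))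
  -- differentiability at `0`: near `0` the clamp is the identity
  have hγd : ∀ b, DifferentiableAt ℝ (fun t => ((γ t b : Matrix.specialUnitaryGroup (Fin 2) ℂ) : Matrix (Fin 2) (Fin 2) ℂ)) 0 := by
    intro b
    have hev : (fun t => ((γ t b : Matrix.specialUnitaryGroup (Fin 2) ℂ) : Matrix (Fin 2) (Fin 2) ℂ)) =ᶠ[𝓝 0]
        fun t => ((GaugeField.gaugeAct (fun x => (a x)⁻¹ * h t x) (W t) b : Matrix.specialUnitaryGroup (Fin 2) ℂ) : Matrix (Fin 2) (Fin 2) ℂ) := by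
      filter_upwards [hcid] with t ht
      show ((GaugeField.gaugeAct (fun x => (a x)⁻¹ * h (c t) x) (W (c t)) b : Matrix.specialUnitaryGroup (Fin 2) ℂ) : Matrix (Fin 2) (Fin 2) ℂ) = _
      rw [ht]
    refine hev.differentiableAt_iff.2 (differentiableAt_coe_gaugeAct (fun t x => (a x)⁻¹ * h t x) W b (fun x => ?_) (hWd b))
    have hx : (fun t => (((a x)⁻¹ * h t x : Matrix.specialUnitaryGroup (Fin 2) ℂ) : Matrix (Fin 2) (Fin 2) ℂ)) =
        fun t => (((a x)⁻¹ : Matrix.specialUnitaryGroup (Fin 2) ℂ) : Matrix (Fin 2) (Fin 2) ℂ) * ((h t x : Matrix.specialUnitaryGroup (Fin 2) ℂ) : Matrix (Fin 2) (Fin 2) ℂ) :=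
      funext fun t => Submonoid.coe_mul _ _ _
    rw [hx]
    exact (differentiableAt_const _).mul (hhd x)
  -- Stat at `U`, gauge invariance, and the clamp removed
  have hst := hstat γ hγ0 hγfib hγd
  have hgauge : (fun t => wilsonAction4 (γ t)) = fun t => wilsonAction4 (W (c t)) := funext fun t => by
    show wilsonAction 1 (GaugeField.gaugeAct (fun x => (a x)⁻¹ * h (c t) x) (W (c t))) = wilsonAction 1 (W (c t))
    exact T4WilsonGaugeFlatDirection.wilsonAction_gaugeAct 1 _ _
  have hev : (fun t => wilsonAction4 (W (c t))) =ᶠ[𝓝 0] fun t => wilsonAction4 (W t) := by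
    filter_upwards [hcid] with t ht
    rw [ht]
  rw [hgauge] at hst
  rwa [hev.deriv_eq] at hst

end Stat

end Summit.QuantumFields.YangMills.Theorems.HalvingCompetitorMapFibreStat

end
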